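import Summits.HubbardSuperconductivity.HubbardSuperconductivity.Theorems.AnisotropyChordTowerSectorFun
import Summits.HubbardSuperconductivity.HubbardSuperconductivity.Theorems.AnisotropyChordTowerGapSolve

/-!
# Route `AnisotropyChord` / H0 rotor rung: SECTOR PLUMBING — the transposition form as a linear map on the amplitudes
# of ONE particle-number sector, with its symmetry, positivity, kernel and gap transported from the full configuration
# space (work-order v13(c) of theory seat `hubbard-h0-rotor-theory-1`, memo ROTOR-THEORY-11 §161 (c); director CYCLE-12 (A))

`Sec V n = {σ : V → Fin 2 // #{x : σ x = 0} = n}` is the sector with `n` up spins; `secExt n f` extends an amplitude on it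
by zero, `secRes n b` restricts.  `secOp G n : (Sec V n → ℝ) →ₗ[ℝ] (Sec V n → ℝ)` is `A = fmOp G` (`½ Σ_E (1 − T_xy)`)
compressed to the sector (it preserves sectors).  Transported facts:

* `sum_secExt_mul` (re-indexing), `secExt_secOp` (`A` preserves the sector);
* full-space lemmas `fmOp_add'`, `fmOp_smul'`, `sum_mul_fmOp_comm` (symmetry of `A` as a bilinear form),
  `inner_fmOp_le` (`⟨b, A b⟩ ≤ (D/2)‖b‖²`, `D` the ordered edge count);
* `secOp_symm`, `secOp_psd`, `secOp_le` (bounded), `secOp_const` (`A 1 = 0`), `secOp_ker_const` (connected graph: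
  `⟨f, A f⟩ = 0 ⇒ f` constant), `secOp_ker_perp` (`… ∧ Σ f = 0 ⇒ f = 0`), and **`secOp_gap`**: on a connected graph
  `∃ γ > 0, Σ f = 0 ⇒ γ‖f‖² ≤ ⟨f, A f⟩` (from `Tower.gap_on_perp`) — hypotheses `hA`, `hAφ₀`, `hgap`, `hker` of
  `Tower.bootstrap` / `Tower.solve_on_perp` / `Tower.eigen_parallel_of_gap` for every sector of every connected graph.
-/

set_option linter.dupNamespace false
set_option autoImplicit false

noncomputable section

open Finset Matrix
open Summit.HubbardSuperconductivity.HubbardSuperconductivity.Theorems.AnisotropyChord.InsertionEntropy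

namespace Summit.HubbardSuperconductivity.HubbardSuperconductivity.Theorems.AnisotropyChord.Tower

variable {V : Type} [Fintype V] [DecidableEq V]

/-! ### Full-space complements on `fmOp` -/

section Full

variable (G : SimpleGraph V) [DecidableRel G.Adj]

/-- `A` is additive. [folklore] -/
theorem fmOp_add' (b c : (V → Fin 2) → ℝ) : fmOp G (b + c) = fmOp G b + fmOp G c := by
  funext σ
  simp only [Pi.add_apply]
  unfold fmOp
  rw [← mul_add, ← Finset.sum_add_distrib]
  congr 1
  refine Finset.sum_congr rfl fun x _ => ?_
  rw [← Finset.sum_add_distrib]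
  refine Finset.sum_congr rfl fun y _ => ?_
  split_ifs
  · simp only [Pi.add_apply]; ring
  · simp

/-- `A` is homogeneous. [folklore] -/
theorem fmOp_smul' (r : ℝ) (b : (V → Fin 2) → ℝ) : fmOp G (r • b) = r • fmOp G b := by
  funext σ
  rw [Pi.smul_apply, smul_eq_mul]
  unfold fmOp
  rw [mul_left_comm]
  congr 1
  rw [Finset.mul_sum]
  refine Finset.sum_congr rfl fun x _ => ?_
  rw [Finset.mul_sum]
  refine Finset.sum_congr rfl fun y _ => ?_
  split_ifs
  · rw [Pi.smul_apply, Pi.smul_apply, smul_eq_mul, smul_eq_mul]; ring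
  · simp

omit [Fintype V] in
/-- `(σ ∘ swap) ∘ swap = σ`. [folklore] -/
private theorem comp_swap_comp_swap' (σ : V → Fin 2) (x y : V) :
    (σ ∘ ⇑(Equiv.swap x y)) ∘ ⇑(Equiv.swap x y) = σ := by
  funext z; simp [Equiv.swap_apply_self]

/-- exchanging a configuration sum with a double site sum. [folklore] -/
private theorem sum_sum₂_comm (g : (V → Fin 2) → V → V → ℝ) :
    ∑ σ, ∑ x, ∑ y, g σ x y = ∑ x, ∑ y, ∑ σ, g σ x y := by
  rw [Finset.sum_comm]
  exact Finset.sum_congr rfl fun _ _ => Finset.sum_comm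

/-- **`A` is symmetric as a bilinear form**: `Σ b·(A c) = Σ (A b)·c`. [folklore] -/
theorem sum_mul_fmOp_comm (b c : (V → Fin 2) → ℝ) :
    ∑ σ, b σ * fmOp G c σ = ∑ σ, fmOp G b σ * c σ := by
  unfold fmOp
  have hL : ∑ σ, b σ * ((1/4 : ℝ) * ∑ x, ∑ y, if G.Adj x y then (c σ - c (σ ∘ ⇑(Equiv.swap x y))) else 0)
      = ∑ σ, ∑ x, ∑ y, (1/4 : ℝ) * (if G.Adj x y then b σ * (c σ - c (σ ∘ ⇑(Equiv.swap x y))) else 0) := by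
    refine Finset.sum_congr rfl fun σ _ => ?_
    rw [Finset.mul_sum, Finset.mul_sum]
    refine Finset.sum_congr rfl fun x _ => ?_
    rw [Finset.mul_sum, Finset.mul_sum]
    refine Finset.sum_congr rfl fun y _ => ?_
    split_ifs <;> ring
  have hR : ∑ σ, ((1/4 : ℝ) * ∑ x, ∑ y, if G.Adj x y then (b σ - b (σ ∘ ⇑(Equiv.swap x y))) else 0) * c σ
      = ∑ σ, ∑ x, ∑ y, (1/4 : ℝ) * (if G.Adj x y then (b σ - b (σ ∘ ⇑(Equiv.swap x y))) * c σ else 0) := by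
    refine Finset.sum_congr rfl fun σ _ => ?_
    rw [Finset.mul_sum, Finset.sum_mul]
    refine Finset.sum_congr rfl fun x _ => ?_
    rw [Finset.mul_sum, Finset.sum_mul]
    refine Finset.sum_congr rfl fun y _ => ?_
    split_ifs <;> ring
  rw [hL, hR, sum_sum₂_comm, sum_sum₂_comm]
  refine Finset.sum_congr rfl fun x _ => Finset.sum_congr rfl fun y _ => ?_
  by_cases hxy : G.Adj x y
  · simp only [hxy, if_true]
    rw [← Finset.mul_sum, ← Finset.mul_sum]
    congr 1
    have hre := sum_comp_swap x y (fun σ => b σ * c (σ ∘ ⇑(Equiv.swap x y)))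
    simp only [comp_swap_comp_swap'] at hre
    have h1 : ∑ σ, b σ * (c σ - c (σ ∘ ⇑(Equiv.swap x y)))
        = ∑ σ, b σ * c σ - ∑ σ, b σ * c (σ ∘ ⇑(Equiv.swap x y)) := by
      rw [← Finset.sum_sub_distrib]; refine Finset.sum_congr rfl fun σ _ => ?_; ring
    have h2 : ∑ σ, (b σ - b (σ ∘ ⇑(Equiv.swap x y))) * c σ
        = ∑ σ, b σ * c σ - ∑ σ, b (σ ∘ ⇑(Equiv.swap x y)) * c σ := by
      rw [← Finset.sum_sub_distrib]; refine Finset.sum_congr rfl fun σ _ => ?_; ring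
    rw [h1, h2, hre]
  · simp [hxy]

omit [DecidableEq V] in
/-- pull a constant into a double sum. [folklore] -/
private theorem smul_sum₂'' (c : ℝ) (F : V → V → ℝ) : c * ∑ x, ∑ y, F x y = ∑ x, ∑ y, c * F x y := by
  rw [Finset.mul_sum]; refine Finset.sum_congr rfl fun x _ => ?_; rw [Finset.mul_sum]

/-- **`A` is bounded**: `⟨b, A b⟩ ≤ (D/2) Σ b²`, `D = Σ_x Σ_y [x ∼ y]`. [folklore] -/
theorem inner_fmOp_le (b : (V → Fin 2) → ℝ) :
    ∑ σ, b σ * fmOp G b σ ≤ ((1/2 : ℝ) * ∑ x, ∑ y, if G.Adj x y then (1:ℝ) else 0) * ∑ σ, b σ ^ 2 := by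
  have hR : ((1/2 : ℝ) * ∑ x, ∑ y, if G.Adj x y then (1:ℝ) else 0) * ∑ σ, b σ ^ 2
      = (1/8 : ℝ) * ∑ x, ∑ y, (if G.Adj x y then 4 * ∑ σ, b σ ^ 2 else 0) := by
    rw [mul_comm, ← mul_assoc, smul_sum₂'', smul_sum₂'']
    refine Finset.sum_congr rfl fun x _ => Finset.sum_congr rfl fun y _ => ?_
    split_ifs <;> ring
  rw [inner_fmOp_eq, hR]
  refine mul_le_mul_of_nonneg_left (Finset.sum_le_sum fun x _ => Finset.sum_le_sum fun y _ => ?_) (by norm_num)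
  by_cases hxy : G.Adj x y
  · simp only [hxy, if_true]
    have hre := sum_comp_swap x y (fun σ => b σ ^ 2)
    calc ∑ σ, (b σ - b (σ ∘ ⇑(Equiv.swap x y))) ^ 2
        ≤ ∑ σ, (2 * b σ ^ 2 + 2 * b (σ ∘ ⇑(Equiv.swap x y)) ^ 2) :=
          Finset.sum_le_sum fun σ _ => by nlinarith [sq_nonneg (b σ + b (σ ∘ ⇑(Equiv.swap x y)))]
      _ = 4 * ∑ σ, b σ ^ 2 := by
          rw [Finset.sum_add_distrib, ← Finset.mul_sum, ← Finset.mul_sum, hre]; ring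
  · simp [hxy]

end Full

/-! ### The sector, extension by zero, restriction -/

/-- The particle-number sector with `n` up spins (`σ x = 0`), as a subtype of the configurations. [folklore] -/
abbrev Sec (V : Type) [Fintype V] [DecidableEq V] (n : ℕ) : Type := {σ : V → Fin 2 // (zeroSet σ).card = n}

/-- Extension by zero of a sector amplitude to all configurations. [folklore] -/
def secExt (n : ℕ) (f : Sec V n → ℝ) : (V → Fin 2) → ℝ :=
  fun σ => if h : (zeroSet σ).card = n then f ⟨σ, h⟩ else 0

/-- Restriction of an amplitude to a sector. [folklore] -/
def secRes (n : ℕ) (b : (V → Fin 2) → ℝ) : Sec V n → ℝ := fun s => b s.1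

/-- `zerosCard = n` on the sector. [folklore] -/
theorem zerosCard_sec {n : ℕ} (s : Sec V n) : zerosCard s.1 = n := by
  rw [zerosCard_eq_card, s.2]

/-- `#zeros = n` iff `zerosCard = n` (as reals). [folklore] -/
theorem card_zeroSet_eq_iff {n : ℕ} (σ : V → Fin 2) : (zeroSet σ).card = n ↔ zerosCard σ = n := by
  rw [zerosCard_eq_card]; exact_mod_cast Iff.rfl

/-- The extension agrees with `f` on the sector. [folklore] -/
@[simp] theorem secExt_apply_sec {n : ℕ} (f : Sec V n → ℝ) (s : Sec V n) : secExt n f s.1 = f s := by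
  unfold secExt; rw [dif_pos s.2]

/-- The extension vanishes off the sector. [folklore] -/
theorem secExt_of_ne {n : ℕ} (f : Sec V n → ℝ) {σ : V → Fin 2} (h : (zeroSet σ).card ≠ n) : secExt n f σ = 0 := by
  unfold secExt; rw [dif_neg h]

/-- Support of the extension. [folklore] -/
theorem secExt_support {n : ℕ} (f : Sec V n → ℝ) : ∀ σ, secExt n f σ ≠ 0 → zerosCard σ = n := by
  intro σ hσ
  by_cases h : (zeroSet σ).card = n
  · exact (card_zeroSet_eq_iff σ).1 h
  · exact absurd (secExt_of_ne f h) hσ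

/-- `res ∘ ext = id`. [folklore] -/
@[simp] theorem secRes_secExt {n : ℕ} (f : Sec V n → ℝ) : secRes n (secExt n f) = f := by
  funext s; exact secExt_apply_sec f s

/-- `ext ∘ res = id` on amplitudes supported on the sector. [folklore] -/
theorem secExt_secRes {n : ℕ} (b : (V → Fin 2) → ℝ) (hb : ∀ σ, b σ ≠ 0 → zerosCard σ = n) :
    secExt n (secRes n b) = b := by
  funext σ
  by_cases h : (zeroSet σ).card = n
  · unfold secExt secRes; rw [dif_pos h]
  · rw [secExt_of_ne _ h]
    by_contra hne
    exact h ((card_zeroSet_eq_iff σ).2 (hb σ (Ne.symm hne)))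

/-- The extension is additive. [folklore] -/
theorem secExt_add {n : ℕ} (f g : Sec V n → ℝ) : secExt n (f + g) = secExt n f + secExt n g := by
  funext σ
  by_cases h : (zeroSet σ).card = n
  · simp only [Pi.add_apply]; unfold secExt; simp [h]
  · simp [secExt_of_ne _ h]

/-- The extension is homogeneous. [folklore] -/
theorem secExt_smul {n : ℕ} (r : ℝ) (f : Sec V n → ℝ) : secExt n (r • f) = r • secExt n f := by
  funext σ
  by_cases h : (zeroSet σ).card = n
  · simp only [Pi.smul_apply, smul_eq_mul]; unfold secExt; simp [h]
  · simp [secExt_of_ne _ h]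

/-- **Re-indexing**: `Σ_σ (ext f)(σ) h(σ) = Σ_{s ∈ sector} f(s) h(s)`. [folklore] -/
theorem sum_secExt_mul {n : ℕ} (f : Sec V n → ℝ) (h : (V → Fin 2) → ℝ) :
    ∑ σ, secExt n f σ * h σ = ∑ s : Sec V n, f s * h s.1 := by
  have h1 : ∑ σ, secExt n f σ * h σ
      = ∑ σ ∈ univ.filter (fun σ : V → Fin 2 => (zeroSet σ).card = n), secExt n f σ * h σ := by
    rw [Finset.sum_filter]
    refine Finset.sum_congr rfl fun σ _ => ?_
    by_cases hσ : (zeroSet σ).card = n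
    · rw [if_pos hσ]
    · rw [if_neg hσ, secExt_of_ne f hσ, zero_mul]
  rw [h1, Finset.sum_subtype (univ.filter fun σ : V → Fin 2 => (zeroSet σ).card = n)
    (p := fun σ : V → Fin 2 => (zeroSet σ).card = n) (fun σ => by simp)]
  refine Finset.sum_congr rfl fun s _ => ?_
  rw [secExt_apply_sec]

/-- The extension of a constant is a function of the particle number. [folklore] -/
theorem secExt_const {n : ℕ} (c : ℝ) :
    secExt n (fun _ : Sec V n => c) = fun σ => if zerosCard σ = (n : ℝ) then c else 0 := by
  funext σ
  by_cases h : (zeroSet σ).card = n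
  · rw [if_pos ((card_zeroSet_eq_iff σ).1 h)]
    unfold secExt; rw [dif_pos h]
  · rw [secExt_of_ne _ h, if_neg (fun h' => h ((card_zeroSet_eq_iff σ).2 h'))]

/-! ### The transposition form compressed to a sector -/

section SecOp

variable (G : SimpleGraph V) [DecidableRel G.Adj]

/-- `A` maps sector-supported amplitudes to sector-supported amplitudes. [folklore] -/
theorem fmOp_secExt_support {n : ℕ} (f : Sec V n → ℝ) :
    ∀ σ, fmOp G (secExt n f) σ ≠ 0 → zerosCard σ = n := by
  intro σ hσ
  by_contra hne
  apply hσ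
  unfold fmOp
  rw [Finset.sum_eq_zero fun x _ => Finset.sum_eq_zero fun y _ => ?_, mul_zero]
  have h1 : secExt n f σ = 0 := by
    by_contra h; exact hne (secExt_support f σ h)
  have h2 : secExt n f (σ ∘ ⇑(Equiv.swap x y)) = 0 := by
    by_contra h
    have := secExt_support f _ h
    rw [zerosCard_comp_perm] at this
    exact hne this
  simp [h1, h2]

/-- **`A_n`**: the transposition form `fmOp G` as a linear map on the amplitudes of the sector with `n` up spins. [folklore] -/
def secOp (n : ℕ) : (Sec V n → ℝ) →ₗ[ℝ] (Sec V n → ℝ) where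
  toFun f := secRes n (fmOp G (secExt n f))
  map_add' f g := by
    funext s; simp only [secRes, secExt_add, fmOp_add', Pi.add_apply]
  map_smul' r f := by
    funext s; simp only [secRes, secExt_smul, fmOp_smul', Pi.smul_apply, smul_eq_mul, RingHom.id_apply]

/-- Unfolding `secOp`. [folklore] -/
theorem secOp_apply {n : ℕ} (f : Sec V n → ℝ) (s : Sec V n) : secOp G n f s = fmOp G (secExt n f) s.1 := rfl

/-- `ext (A_n f) = A (ext f)`. [folklore] -/
theorem secExt_secOp {n : ℕ} (f : Sec V n → ℝ) : secExt n (secOp G n f) = fmOp G (secExt n f) :=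
  secExt_secRes _ (fmOp_secExt_support G f)

/-- `⟨f, A_n g⟩ = Σ_σ (ext f)(A ext g)`. [folklore] -/
theorem dot_secOp {n : ℕ} (f g : Sec V n → ℝ) :
    f ⬝ᵥ secOp G n g = ∑ σ, secExt n f σ * fmOp G (secExt n g) σ := by
  rw [sum_secExt_mul]; rfl

/-- **`A_n` is symmetric.** [folklore] -/
theorem secOp_symm {n : ℕ} (f g : Sec V n → ℝ) : f ⬝ᵥ secOp G n g = secOp G n f ⬝ᵥ g := by
  rw [dot_secOp, sum_mul_fmOp_comm, ← secExt_secOp, sum_secExt_mul]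
  simp only [secExt_apply_sec]
  rfl

/-- **`A_n ⪰ 0`.** [folklore] -/
theorem secOp_psd {n : ℕ} (f : Sec V n → ℝ) : 0 ≤ f ⬝ᵥ secOp G n f := by
  rw [dot_secOp]; exact inner_fmOp_nonneg G _

/-- `Σ (ext f)² = f ⬝ f`. [folklore] -/
theorem sum_secExt_sq {n : ℕ} (f : Sec V n → ℝ) : ∑ σ, secExt n f σ ^ 2 = f ⬝ᵥ f := by
  have h := sum_secExt_mul f (secExt n f)
  simp only [secExt_apply_sec] at h
  rw [show (∑ σ, secExt n f σ ^ 2) = ∑ σ, secExt n f σ * secExt n f σ from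
    Finset.sum_congr rfl fun σ _ => by ring, h]
  rfl

/-- **`A_n` is bounded**: `⟨f, A_n f⟩ ≤ (D/2)‖f‖²`. [folklore] -/
theorem secOp_le {n : ℕ} (f : Sec V n → ℝ) :
    f ⬝ᵥ secOp G n f ≤ ((1/2 : ℝ) * ∑ x, ∑ y, if G.Adj x y then (1:ℝ) else 0) * (f ⬝ᵥ f) := by
  rw [dot_secOp, ← sum_secExt_sq]; exact inner_fmOp_le G _

/-- **`A_n` kills the constants** (`φ₀ ∈ ker A_n`). [folklore] -/
theorem secOp_const {n : ℕ} (c : ℝ) : secOp G n (fun _ => c) = 0 := by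
  funext s
  rw [secOp_apply, secExt_const]
  have h := fmOp_sectorFun G (fun t : ℝ => if t = (n : ℝ) then c else 0)
  beta_reduce at h
  rw [h]
  rfl

/-- **Kernel of the form on a connected graph**: `⟨f, A_n f⟩ = 0 ⇒ f` is constant. [folklore] -/
theorem secOp_ker_const (hconn : G.Connected) {n : ℕ} (f : Sec V n → ℝ) (h0 : f ⬝ᵥ secOp G n f = 0) :
    ∀ s s' : Sec V n, f s = f s' := by
  rw [dot_secOp] at h0
  have hinv := swapInvariant_of_inner_fmOp_eq_zero G (secExt n f) h0
  have hsec := sectorFun_of_edgeSwapInvariant G hconn (secExt n f) hinv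
  intro s s'
  have := hsec s.1 s'.1 (by rw [zerosCard_sec, zerosCard_sec])
  simpa using this

/-- **Trivial kernel on `1^⟂`**: `Σ f = 0 ∧ ⟨f, A_n f⟩ = 0 ⇒ f = 0` (connected graph). [folklore] -/
theorem secOp_ker_perp (hconn : G.Connected) {n : ℕ} (f : Sec V n → ℝ) (hsum : ∑ s, f s = 0)
    (h0 : f ⬝ᵥ secOp G n f = 0) : f = 0 := by
  have hc := secOp_ker_const G hconn f h0
  funext s
  have h1 : ∑ s' : Sec V n, f s' = ∑ _s' : Sec V n, f s := Finset.sum_congr rfl fun s' _ => hc s' s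
  rw [h1, Finset.sum_const, Finset.card_univ, nsmul_eq_mul] at hsum
  have hcard : (0 : ℝ) < Fintype.card (Sec V n) := by exact_mod_cast Fintype.card_pos_iff.2 ⟨s⟩
  simpa [hcard.ne'] using hsum

/-- `⟨1, f⟩ = Σ f`. [folklore] -/
theorem one_dot_eq_sum {n : ℕ} (f : Sec V n → ℝ) : (fun _ : Sec V n => (1:ℝ)) ⬝ᵥ f = ∑ s, f s := by
  unfold dotProduct; simp

/-- **THE SECTOR GAP** (hypothesis `hgap` of `Tower.bootstrap`): on a connected graph, for every sector, there is
`γ > 0` with `γ‖f‖² ≤ ⟨f, A_n f⟩` whenever `Σ f = 0`. (Compactness, `Tower.gap_on_perp`; the value — the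
interchange-process gap, `1 − cos(2π/L)` on the torus — is not needed.) [folklore] -/
theorem secOp_gap (hconn : G.Connected) (n : ℕ) :
    ∃ γ : ℝ, 0 < γ ∧ ∀ f : Sec V n → ℝ, ∑ s, f s = 0 → γ * (f ⬝ᵥ f) ≤ f ⬝ᵥ secOp G n f := by
  obtain ⟨γ, hγ, h⟩ := gap_on_perp (secOp G n) (fun _ => (1:ℝ)) (secOp_psd G)
    (fun χ hχ h0 => secOp_ker_perp G hconn χ (by rwa [one_dot_eq_sum] at hχ) h0)
  exact ⟨γ, hγ, fun f hf => h f (by rw [one_dot_eq_sum]; exact hf)⟩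

/-- **SOLVING `A_n v = u` on `1^⟂`** (connected graph): every `u` with `Σ u = 0` is `A_n v` for some `v` with
`Σ v = 0` (`Tower.solve_on_perp`). [folklore] -/
theorem secOp_solve (hconn : G.Connected) {n : ℕ} (u : Sec V n → ℝ) (hu : ∑ s, u s = 0) :
    ∃ v : Sec V n → ℝ, ∑ s, v s = 0 ∧ secOp G n v = u := by
  obtain ⟨v, hv, hAv⟩ := solve_on_perp (secOp G n) (fun f g => secOp_symm G f g) (fun _ => (1:ℝ))
    (secOp_const G 1) (fun χ hχ h0 => secOp_ker_perp G hconn χ (by rwa [one_dot_eq_sum] at hχ) h0)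
    u (by rw [one_dot_eq_sum]; exact hu)
  exact ⟨v, by rw [← one_dot_eq_sum]; exact hv, hAv⟩

end SecOp

end Summit.HubbardSuperconductivity.HubbardSuperconductivity.Theorems.AnisotropyChord.Tower
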